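import Literature.NumberTheory.NumberFields.AmbiguousClassNumberInequality
import Literature.NumberTheory.NumberFields.NarrowClassGroup
import HarnessLib

/-!
# Chevalley's ambiguous class number formula at `p = 2` with the NARROW class number of the base: for `L/K` quadratic with
# `L` totally complex, `ord₂ #Cl(L)^G + 1 ≤ ord₂ h⁺(K) + t` — NO hypothesis on the units of `K` (proved; no definition, no named fact)

`Proofs`-style file (theorems only) in topic `NumberTheory/NumberFields` (namespace `Literature.NumberTheory.NumberFields.AmbiguousClass`,
that of `AmbiguousClassNumberFormula.lean` / `AmbiguousClassNumberInequality.lean`), written by the prover seat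
`cruxlead-stmt-BirchSwinnertonDyer-19573-w2` GEN 8 (cell `bsd-2adic`; `--supports` stmt-BirchSwinnertonDyer-19573; closes nothing).
Module (L⁺) of the seat's «Kida-lite at `ℓ = 2`»: the per-layer input of the quadratic `μ`-ascent under a bounded NARROW defect
(`ClassicalMuVanishesQuadraticAscentNarrow.lean`).

THE POINT.  GEN 7's `AmbiguousClass.padicValNat_two_card_fixed_add_one_le_of_signVec_surjective` cancels the archimedean factor
`∏_{v∣∞} e_v = 2^{r₁(K)}` of Chevalley's formula (`L` totally complex) against the unit norm index `[E_K : E_K ∩ N Lˣ]` under the hypothesis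
that the unit signature map of `K` is ONTO.  Without any hypothesis one still has `E_K ∩ N Lˣ ⊆ E_K⁺` (a norm from the totally complex `L`
is positive at every real place of `K`), so `#sign(E_K) = [E_K : E_K⁺]` divides the index (§1), and Fröhlich–Taylor's
`h⁺(K) · #sign(E_K) = h(K) · 2^{r₁(K)}` (tree `narrowClassNumber_mul_card_unitSignatures`, Ch. V §1 (1.12)) says that the missing signatures are
EXACTLY the factor `h⁺(K)/h(K)`.  Hence (§2), for `L/K` Galois of degree `2` with `L` totally complex and `t` finite primes of `K` ramified in `L`:

  **`ord₂ #Cl(L)^G + 1 ≤ ord₂ h⁺(K) + t`**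

— Chevalley at `2` «with the narrow class number», the form in which genus theory with signatures is usually quoted (Gras, IV.4); GEN 7's
inequality is the case `#sign(E_K) = 2^{r₁(K)}` (then `ord₂ h⁺(K) = ord₂ h(K)`).  The difference `δ(K) := ord₂ h⁺(K) − ord₂ h(K)` is the
«narrow defect» whose boundedness along a `ℤ₂`-tower is the hypothesis of the Kida-lite ascent.

* §1 `range_signHom_comp_unitsMap` (`sign(E_K)` through `𝓞_Kˣ`), **`card_unitSignatures_dvd_relIndex`** (`#sign(E_K) ∣ [E_K : E_K ∩ N Lˣ]`,
  `L/K` cyclic, `L` totally complex), `padicValNat_narrowClassNumber_add_card_unitSignatures`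
  (`ord_p h⁺ + ord_p #sign = ord_p h + ord_p 2^{r₁}`), `narrowClassNumber_ne_zero`.
* §2 **`padicValNat_two_card_fixed_add_one_le_narrowClassNumber`** (the displayed inequality) and its wording with `Nat.card (ClassGroup)`,
  `padicValNat_two_card_fixed_le_natCard_classGroup_add_of_narrow` (`ord₂ #Cl(L)^G ≤ ord₂ #Cl(K) + (t − 1) + (ord₂ h⁺(K) − ord₂ h(K))`, the
  shape consumed by `CyclicRankBound.padicValNat_card_quotient_le_of_fixed`).

References: [Lang1990] Ch. 13 §4 Lemma 4.1 (PDF p. 203); [Gras2003] II.6.2.3, IV.4 (genus theory with signatures); [FrohlichTaylor1990] Ch. V §1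
(1.10)–(1.12), pp. 163–164; [Kida1982JFields] Y. Kida, *Cyclotomic ℤ₂-extensions of J-fields*, J. Number Theory 14 (1982) 340–352 (the
`μ`-part of whose transfer this inequality feeds; shape only, not held); [Iwasawa1973MuInvariants] Thm. 2/3.
-/

set_option autoImplicit false

noncomputable section

open NumberField NumberField.InfinitePlace IsDedekindDomain
open scoped nonZeroDivisors Classical

namespace Literature.NumberTheory.NumberFields.AmbiguousClass

open Literature.NumberTheory.GaloisRepresentations Literature.NumberTheory.GaloisRepresentations.Herbrand
  Literature.NumberTheory.GaloisRepresentations.MinkowskiUnit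
  Literature.NumberTheory.GaloisRepresentations.CyclicNormIndex
  Literature.Geometry.Kaehler.ComplexTorus

variable {K L : Type} [Field K] [NumberField K] [Field L] [NumberField L] [Algebra K L]

/-- `a ∣ b ≠ 0 ⟹ ord_p a ≤ ord_p b`. [folklore] -/
private theorem padicValNat_le_of_dvd {p a b : ℕ} [Fact p.Prime] (hb : b ≠ 0) (h : a ∣ b) :
    padicValNat p a ≤ padicValNat p b :=
  (padicValNat_dvd_iff_le hb).1 (pow_padicValNat_dvd.trans h)

/-! ## §1 The unit signatures divide the unit norm index -/

omit [NumberField K] in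
/-- The signature homomorphism `𝓞_Kˣ → Kˣ → ⟨±1⟩^{r₁}` has image `sign(E_K) = sign(U)` (`U = unitsRange K ≤ Kˣ` the units of `𝓞_K`).
[cite: FrohlichTaylor1990, Ch. V §1 (1.12) ("U_N/U_N⁺ → ⟨±1⟩^{(s)}"), p. 164] -/
theorem range_signHom_comp_unitsMap :
    ((Literature.NumberTheory.NumberFields.signHom K).comp (Units.map (algebraMap (𝓞 K) K : 𝓞 K →* K))).range =
      (unitsRange K).map (Literature.NumberTheory.NumberFields.signHom K) := by
  rw [MonoidHom.range_comp]
  rfl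

/-- **`#sign(E_K)` divides the unit norm index `[E_K : E_K ∩ N_{L/K} Lˣ]`** for `L/K` cyclic with `L` TOTALLY COMPLEX — no hypothesis on the
units: a unit of `K` that is a norm from `Lˣ` is positive at every real place of `K` (k4-w2's `coe_herbrandNorm_eq_algebraMap_norm` +
`embedding_norm_pos_of_totallyPositive`; `L` has no real embedding), so `E_K ∩ N Lˣ ≤ ker(sign) = E_K⁺` and
`[E_K : E_K ∩ N Lˣ] = [E_K : E_K⁺]·[E_K⁺ : E_K ∩ N Lˣ]` with `[E_K : E_K⁺] = #sign(E_K)`. (GEN 7's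
`two_pow_nrRealPlaces_dvd_relIndex_of_signVec_surjective` is the case `#sign(E_K) = 2^{r₁(K)}`.)
[cite: Gras2003, IV.4 (genus theory with signatures)] [cite: FrohlichTaylor1990, Ch. V §1 (1.10)–(1.12), pp. 163–164] -/
theorem card_unitSignatures_dvd_relIndex [IsGalois K L] [IsTotallyComplex L] {σ : L ≃ₐ[K] L}
    (hσ : ∀ τ : L ≃ₐ[K] L, τ ∈ Subgroup.zpowers σ) :
    Nat.card ((unitsRange K).map (Literature.NumberTheory.NumberFields.signHom K)) ∣
      (unitsE L ⊓ (⊤ : Subgroup Lˣ).map (Herbrand.norm (L ≃ₐ[K] L))).relIndex (unitsE L ⊓ (unitsIncl K L).range) := by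
  classical
  set Φ : (𝓞 K)ˣ →* Lˣ := (unitsIncl K L).comp (Units.map (algebraMap (𝓞 K) K : 𝓞 K →* K)) with hΦ
  set A : Subgroup Lˣ := unitsE L ⊓ (⊤ : Subgroup Lˣ).map (Herbrand.norm (L ≃ₐ[K] L)) with hA
  -- the index as an index in `𝓞_Kˣ`
  have hidx : A.relIndex (unitsE L ⊓ (unitsIncl K L).range) = (A.comap Φ).index := by
    rw [← range_unitsIncl_comp_unitsMap_eq, hΦ, Subgroup.index_comap]
  -- the signature homomorphism on `𝓞_Kˣ`
  set Sg : (𝓞 K)ˣ →* Multiplicative ((K →+* ℝ) → ZMod 2) :=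
    (Literature.NumberTheory.NumberFields.signHom K).comp (Units.map (algebraMap (𝓞 K) K : 𝓞 K →* K)) with hSg
  -- norms are totally positive: `A.comap Φ ≤ ker Sg`
  have hle : A.comap Φ ≤ Sg.ker := by
    intro u hu
    rw [Subgroup.mem_comap, hA] at hu
    obtain ⟨-, ⟨y, -, hy⟩⟩ := Subgroup.mem_inf.mp hu
    rw [MonoidHom.mem_ker, hSg, MonoidHom.comp_apply, ← MonoidHom.mem_ker, Literature.NumberTheory.NumberFields.mem_ker_signHom_iff]
    intro ρ
    -- `(u : K) = N_{L/K}(y)`, and norms from the totally complex `L` are positive at `ρ`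
    have hval : algebraMap K L (((Units.map (algebraMap (𝓞 K) K : 𝓞 K →* K) u : Kˣ) : K)) =
        algebraMap K L (Algebra.norm K (y : L)) := by
      rw [← coe_herbrandNorm_eq_algebraMap_norm hσ y, hy, ← coe_unitsIncl (L := L)]
      rfl
    rw [(algebraMap K L).injective hval]
    refine embedding_norm_pos_of_totallyPositive (Units.ne_zero y) (fun τ ↦ ?_) ρ
    exfalso
    have hφ : ComplexEmbedding.IsReal (Complex.ofRealHom.comp τ) := by
      rw [ComplexEmbedding.isReal_iff]; ext x; simp [ComplexEmbedding.conjugate_coe_eq]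
    have hw : (InfinitePlace.mk (Complex.ofRealHom.comp τ)).IsReal := ⟨_, hφ, rfl⟩
    exact (not_isReal_iff_isComplex.mpr (IsTotallyComplex.isComplex _)) hw
  -- `[𝓞_Kˣ : ker Sg] = #sign(E_K)`
  have hker : Sg.ker.index = Nat.card ((unitsRange K).map (Literature.NumberTheory.NumberFields.signHom K)) := by
    rw [Subgroup.index_ker, ← range_signHom_comp_unitsMap (K := K)]
  rw [hidx, ← Subgroup.relIndex_mul_index hle, hker]
  exact Dvd.intro_left _ rfl

/-- `h⁺(K) ≠ 0` (`h⁺ · #sign = h · 2^{r₁} ≠ 0`).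
[cite: FrohlichTaylor1990, Ch. V §1 (1.12), p. 164] -/
theorem narrowClassNumber_ne_zero : narrowClassNumber K ≠ 0 := by
  intro h0
  have h := narrowClassNumber_mul_card_unitSignatures K
  rw [h0, zero_mul] at h
  exact mul_ne_zero (classNumber_pos K).ne' (pow_ne_zero _ two_ne_zero) h.symm

/-- `#sign(E_K) ≠ 0`. [cite: FrohlichTaylor1990, Ch. V §1 (1.12), p. 164] -/
theorem card_unitSignatures_ne_zero : Nat.card ((unitsRange K).map (Literature.NumberTheory.NumberFields.signHom K)) ≠ 0 := by
  intro h0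
  have h := narrowClassNumber_mul_card_unitSignatures K
  rw [h0, mul_zero] at h
  exact mul_ne_zero (classNumber_pos K).ne' (pow_ne_zero _ two_ne_zero) h.symm

/-- **`ord_p h⁺(K) + ord_p #sign(E_K) = ord_p h(K) + ord_p 2^{r₁(K)}`** — Fröhlich–Taylor's (1.12) `h⁺ · #sign(U) = h · 2^{r₁}` on valuations
(`r₁(K)` = the number of real embeddings = `nrRealPlaces K`). [cite: FrohlichTaylor1990, Ch. V §1 (1.12), p. 164] -/
theorem padicValNat_narrowClassNumber_add_card_unitSignatures (p : ℕ) [hp : Fact p.Prime] :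
    padicValNat p (narrowClassNumber K) + padicValNat p (Nat.card ((unitsRange K).map (Literature.NumberTheory.NumberFields.signHom K))) =
      padicValNat p (classNumber K) + padicValNat p (2 ^ nrRealPlaces K) := by
  have h := narrowClassNumber_mul_card_unitSignatures K
  rw [card_realEmbeddings_eq_nrRealPlaces] at h
  rw [← padicValNat.mul (narrowClassNumber_ne_zero (K := K)) (card_unitSignatures_ne_zero (K := K)), h,
    padicValNat.mul (classNumber_pos K).ne' (pow_ne_zero _ two_ne_zero)]

/-! ## §2 Chevalley at `2` with the narrow class number -/

/-- **Chevalley at `p = 2` as an inequality with the NARROW class number of the base, no unit hypothesis.** `L/K` Galois of degree `2`,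
`L` totally complex, `t` the number of finite primes of `K` ramified in `L`: **`ord₂ #Cl(L)^G + 1 ≤ ord₂ h⁺(K) + t`**.  From the valuation
identity `ord₂ #Cl(L)^G + 1 + ord₂ [E_K : E_K ∩ N Lˣ] = ord₂ h(K) + t + r₁(K)` (`padicValNat_card_fixed_add_eq`, archimedean factor `2^{r₁(K)}`),
`#sign(E_K) ∣ [E_K : E_K ∩ N Lˣ]` (§1) and `ord₂ h⁺ + ord₂ #sign = ord₂ h + r₁`.  GEN 7's
`padicValNat_two_card_fixed_add_one_le_of_signVec_surjective` is the case `#sign(E_K) = 2^{r₁(K)}` (then `ord₂ h⁺ = ord₂ h`).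
[cite: Lang1990, Ch. 13 §4, Lemma 4.1 (PDF p. 203)] [cite: Gras2003, IV.4] [cite: FrohlichTaylor1990, Ch. V §1 (1.12), p. 164]
[cite: Iwasawa1973MuInvariants, Thm. 2/3 (the «totally imaginary» proviso, here replaced by nothing at the price of h⁺)] -/
theorem padicValNat_two_card_fixed_add_one_le_narrowClassNumber [IsGalois K L] [IsTotallyComplex L]
    (h2 : Module.finrank K L = 2) {σ : L ≃ₐ[K] L} (hσ : ∀ τ : L ≃ₐ[K] L, τ ∈ Subgroup.zpowers σ) :
    padicValNat 2 (Nat.card {c : ClassGroup (𝓞 L) // ∀ τ : L ≃ₐ[K] L, ClassGroup.mulEquiv (intAut τ) c = c}) + 1 ≤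
      padicValNat 2 (narrowClassNumber K) + {v : HeightOneSpectrum (𝓞 K) | v.asIdeal.ramificationIdxIn (𝓞 L) ≠ 1}.ncard := by
  haveI : Fact (Nat.Prime 2) := ⟨Nat.prime_two⟩
  have hid := padicValNat_card_fixed_add_eq (K := K) (L := L) Nat.prime_two h2 hσ
  rw [archFactor_eq_two_pow_nrRealPlaces_of_isTotallyComplex] at hid
  have hFT := padicValNat_narrowClassNumber_add_card_unitSignatures (K := K) 2
  have hdvd := card_unitSignatures_dvd_relIndex (K := K) (L := L) hσ
  have hne : (unitsE L ⊓ (⊤ : Subgroup Lˣ).map (Herbrand.norm (L ≃ₐ[K] L))).relIndex (unitsE L ⊓ (unitsIncl K L).range) ≠ 0 := by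
    intro h0
    have hform := ambiguousClassNumberFormula hσ
    rw [h0, mul_zero] at hform
    exact mul_ne_zero (mul_ne_zero (classNumber_pos K).ne'
      (by rw [finprod_ramificationIdxIn_eq_pow_of_prime Nat.prime_two h2]; exact pow_ne_zero _ two_ne_zero))
      ArchHerbrand.archFactor_ne_zero hform.symm
  have hle := padicValNat_le_of_dvd (p := 2) hne hdvd
  omega

/-- The same inequality with `#Cl(K)` written as `Nat.card (ClassGroup (𝓞 K))` and the narrow DEFECT `ord₂ h⁺(K) − ord₂ h(K)` displayed:
**`ord₂ #Cl(L)^G + 1 ≤ ord₂ #Cl(K) + t + (ord₂ h⁺(K) − ord₂ h(K))`** (`h ∣ h⁺`, so the subtraction is exact) — the shape fed to the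
rank bound `CyclicRankBound.padicValNat_card_quotient_le_of_fixed` in the quadratic `μ`-ascent. [cite: Lang1990, Ch. 13 §4, Lemma 4.1 (PDF p. 203)]
[cite: FrohlichTaylor1990, Ch. V §1 (1.8), (1.12), pp. 163–164] -/
theorem padicValNat_two_card_fixed_add_one_le_natCard_classGroup_add_narrowDefect [IsGalois K L] [IsTotallyComplex L]
    (h2 : Module.finrank K L = 2) {σ : L ≃ₐ[K] L} (hσ : ∀ τ : L ≃ₐ[K] L, τ ∈ Subgroup.zpowers σ) :
    padicValNat 2 (Nat.card {c : ClassGroup (𝓞 L) // ∀ τ : L ≃ₐ[K] L, ClassGroup.mulEquiv (intAut τ) c = c}) + 1 ≤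
      padicValNat 2 (Nat.card (ClassGroup (𝓞 K))) + {v : HeightOneSpectrum (𝓞 K) | v.asIdeal.ramificationIdxIn (𝓞 L) ≠ 1}.ncard +
        (padicValNat 2 (narrowClassNumber K) - padicValNat 2 (classNumber K)) := by
  haveI : Fact (Nat.Prime 2) := ⟨Nat.prime_two⟩
  have h := padicValNat_two_card_fixed_add_one_le_narrowClassNumber (K := K) (L := L) h2 hσ
  have hcl : classNumber K = Nat.card (ClassGroup (𝓞 K)) := by rw [classNumber, Nat.card_eq_fintype_card]
  have hdvd : padicValNat 2 (classNumber K) ≤ padicValNat 2 (narrowClassNumber K) :=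
    padicValNat_le_of_dvd (p := 2) (narrowClassNumber_ne_zero (K := K)) (classNumber_dvd_narrowClassNumber K)
  rw [← hcl]
  omega

end Literature.NumberTheory.NumberFields.AmbiguousClass

end
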